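import Literature.Topology.CoveringSpaces.CoveringConnectedIdRigid
import Literature.GroupTheory.FreeGroupFiniteIndexSubgroups
import Literature.AlgebraicTopology.FundamentalGroup.QuotientCoveringConjugation
import HarnessLib

/-!
# Finite covers of a space with free fundamental group have slim `π̂₁`; their covering categories are id-rigid

Topic `Literature/Topology/CoveringSpaces` — campaign-L R1 (abc-iut cell, GAP row G-L4t14-R1),
support for the geometric `EA` column of [AbsTopIII] Prop. 4.2 (i) / Cor 4.5: the per-object input
«`Z(π̂₁(𝕐^top)) = 1`» for EVERY finite connected cover `𝕐` of `ℂ ∖ F` (not only for `ℂ ∖ F`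
itself).  For a covering map `p : E → X` with path-connected total space and a finite (nonempty)
fibre, `p_* : π₁(E, e) → π₁(X, x)` is injective (Hatcher Prop. 1.31, the tree's
`mapOfEq_injective_of_isCoveringMap`) with image of finite index `= #p⁻¹(x)` (Prop. 1.32,
`CoverMonodromy.index_range_mapOfEq_eq_natCard_fiber`); so if `π₁(X, x)` is free on `≥ 2` letters,
`π₁(E, e)` is a finite-index subgroup of a free group, hence non-abelian free with SLIM profinite
completion (`isSlimGroup_profiniteCompletion_of_injective_finiteIndex`, [AbsAnab] Lemma 1.3.1):

* `finiteIndex_range_mapOfEq` — `p_* π₁(E, e)` has finite index for a finite fibre;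
* **`isSlimGroup_profiniteCompletion_fundamentalGroup_of_isCoveringMap`** (+ `_fin`) — `π̂₁(E, e)`
  is slim; `center_profiniteCompletion_fundamentalGroup_eq_bot_of_isCoveringMap` — hence centre-free;
* `CovFin.isIdRigid_of_isCoveringMap_freeGroup`, `CovFin.isIdRigid_connected_of_isCoveringMap_freeGroup`
  — for `E` moreover strongly locally contractible (e.g. a manifold): the categories of finite covers
  / of CONNECTED finite covers of `E` are id-rigid (the tree's `CovFin.isIdRigid_of_isSlimGroup`,
  `CovFin.isIdRigid_connected_of_isSlimGroup`);
* `isSlimGroup_profiniteCompletion_fundamentalGroup_of_isCoveringMap_compl_finite` and the two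
  id-rigidity corollaries `…_compl_finite` — **every finite connected cover of `ℂ ∖ F`, `F` finite with
  `2 ≤ |F|`, has slim `π̂₁` and id-rigid (connected) finite-cover categories**.

Everything is proved; no definitions, no named facts. Classical; nothing here bears on
[IUTchIII] Cor. 3.12.

## References

* A. Hatcher, *Algebraic Topology*, CUP 2002, §1.3 Props. 1.31, 1.32. [HatcherAT2002]
* R. C. Lyndon, P. E. Schupp, *Combinatorial Group Theory*, Springer 2001, Ch. I Prop. 3.8
  (Nielsen–Schreier) and Prop. 2.19. [LyndonSchupp2001]
* S. Mochizuki, *The absolute anabelian geometry of hyperbolic curves* (2004), Lemma 1.3.1.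
  [MochizukiAbsAnab2004]
-/

noncomputable section

open Function
open Literature.AlgebraicGeometry.Frobenioids (IsSlimGroup)
open Literature.AnabelianGeometry.AbsoluteAnabelian (IsIdRigid)
open Literature.IUT.HodgeTheaters (profiniteCompletion)
open Literature.GroupTheory Literature.AlgebraicTopology.FundamentalGroup

universe u v

namespace Literature.Topology.CoveringSpaces

/-! ### §1 Slimness of `π̂₁` of a finite cover of a space with free `π₁` -/

section Slim

variable {E : Type u} {X : Type u} [TopologicalSpace E] [TopologicalSpace X] {p : E → X}

/-- **`p_* π₁(E, e)` has finite index for a covering with finite fibre** and path-connected total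
space: the index is the number of sheets (Hatcher, Prop. 1.32). [cite: HatcherAT2002, §1.3 Prop. 1.32] -/
theorem finiteIndex_range_mapOfEq [PathConnectedSpace E] (hp : IsCoveringMap p) {x : X}
    (e : p ⁻¹' {x}) [Finite (p ⁻¹' {x})] :
    (FundamentalGroup.mapOfEq ⟨p, hp.continuous⟩ e.2).range.FiniteIndex := by
  refine ⟨?_⟩
  rw [CoverMonodromy.index_range_mapOfEq_eq_natCard_fiber hp e]
  exact Nat.card_ne_zero.2 ⟨⟨e⟩, inferInstance⟩

/-- **A finite connected cover of a space whose fundamental group is free on at least two letters has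
SLIM profinite completion of its fundamental group**: `p_*` embeds `π₁(E, e)` as a finite-index
subgroup of `π₁(X, x) ≅ FreeGroup ι` (Hatcher 1.31/1.32), a non-abelian free group (Nielsen–Schreier),
whose profinite completion is slim ([AbsAnab] Lemma 1.3.1).
[cite: MochizukiAbsAnab2004, Lemma 1.3.1 p.15] [cite: HatcherAT2002, §1.3 Prop. 1.31] -/
theorem isSlimGroup_profiniteCompletion_fundamentalGroup_of_isCoveringMap [PathConnectedSpace E]
    (hp : IsCoveringMap p) {x : X} {ι : Type v} (φ : FundamentalGroup X x ≃* FreeGroup ι) {a b : ι}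
    (hab : a ≠ b) (e : p ⁻¹' {x}) [Finite (p ⁻¹' {x})] :
    IsSlimGroup (profiniteCompletion (FundamentalGroup E (e : E))) := by
  haveI := finiteIndex_range_mapOfEq hp e
  exact isSlimGroup_profiniteCompletion_of_injective_finiteIndex φ
    (FundamentalGroup.mapOfEq ⟨p, hp.continuous⟩ e.2) (mapOfEq_injective_of_isCoveringMap hp e) hab

/-- The `Fin n` form: `π₁(X, x) ≅ FreeGroup (Fin n)` with `2 ≤ n`.
[cite: MochizukiAbsAnab2004, Lemma 1.3.1 p.15] [cite: HatcherAT2002, §1.3 Prop. 1.31] -/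
theorem isSlimGroup_profiniteCompletion_fundamentalGroup_of_isCoveringMap_fin [PathConnectedSpace E]
    (hp : IsCoveringMap p) {x : X} {n : ℕ} (φ : FundamentalGroup X x ≃* FreeGroup (Fin n))
    (hn : 2 ≤ n) (e : p ⁻¹' {x}) [Finite (p ⁻¹' {x})] :
    IsSlimGroup (profiniteCompletion (FundamentalGroup E (e : E))) :=
  isSlimGroup_profiniteCompletion_fundamentalGroup_of_isCoveringMap hp φ
    (a := (⟨0, by omega⟩ : Fin n)) (b := ⟨1, by omega⟩) (by simp [Fin.ext_iff]) e

/-- Hence `π̂₁(E, e)` is centre-free (slim ⇒ the centraliser of the open subgroup `⊤` is trivial).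
[cite: MochizukiAbsAnab2004, Lemma 1.3.1 p.15] -/
theorem center_profiniteCompletion_fundamentalGroup_eq_bot_of_isCoveringMap [PathConnectedSpace E]
    (hp : IsCoveringMap p) {x : X} {n : ℕ} (φ : FundamentalGroup X x ≃* FreeGroup (Fin n))
    (hn : 2 ≤ n) (e : p ⁻¹' {x}) [Finite (p ⁻¹' {x})] :
    Subgroup.center (profiniteCompletion (FundamentalGroup E (e : E))) = ⊥ := by
  have h := (isSlimGroup_profiniteCompletion_fundamentalGroup_of_isCoveringMap_fin hp φ hn e)
    |>.centralizer_eq_bot ⊤ isOpen_univ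
  rwa [Subgroup.coe_top, Subgroup.centralizer_univ] at h

end Slim

/-! ### §2 Id-rigidity of the covering categories of such a cover -/

section IdRigid

variable {E : Type} {X : Type} [TopologicalSpace E] [TopologicalSpace X] {p : E → X}

/-- **The category of finite covering spaces of a finite connected cover of a free-`π₁` space is
id-rigid** (the cover path connected and strongly locally contractible, e.g. a manifold): the tree's
`CovFin.isIdRigid_of_isSlimGroup` at the slim `π̂₁(E, e)`.
[cite: MochizukiAbsTopIII2015, Proposition 4.2 (i) p.106] -/
theorem CovFin.isIdRigid_of_isCoveringMap_freeGroup [PathConnectedSpace E]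
    [StronglyLocallyContractibleSpace E] (hp : IsCoveringMap p) {x : X} {n : ℕ}
    (φ : FundamentalGroup X x ≃* FreeGroup (Fin n)) (hn : 2 ≤ n) (e : p ⁻¹' {x})
    [Finite (p ⁻¹' {x})] : IsIdRigid (CovFin E) :=
  CovFin.isIdRigid_of_isSlimGroup (e : E)
    (isSlimGroup_profiniteCompletion_fundamentalGroup_of_isCoveringMap_fin hp φ hn e)

/-- **The category of CONNECTED finite covering spaces of a finite connected cover of a free-`π₁`
space is id-rigid** — the per-object input of [AbsTopIII] Prop. 4.2 (i)'s «objects mapping to `𝕐`»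
at every finite connected cover `𝕐` of the base. [cite: MochizukiAbsTopIII2015, Proposition 4.2 (i) p.106] -/
theorem CovFin.isIdRigid_connected_of_isCoveringMap_freeGroup [PathConnectedSpace E]
    [StronglyLocallyContractibleSpace E] (hp : IsCoveringMap p) {x : X} {n : ℕ}
    (φ : FundamentalGroup X x ≃* FreeGroup (Fin n)) (hn : 2 ≤ n) (e : p ⁻¹' {x})
    [Finite (p ⁻¹' {x})] :
    IsIdRigid (CategoryTheory.ObjectProperty.FullSubcategory
      fun F : CovFin E => ConnectedSpace F.obj.left) :=
  CovFin.isIdRigid_connected_of_isSlimGroup (e : E)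
    (isSlimGroup_profiniteCompletion_fundamentalGroup_of_isCoveringMap_fin hp φ hn e)

end IdRigid

/-! ### §3 Every finite connected cover of `ℂ ∖ F`, `2 ≤ |F| < ∞` -/

section PuncturedPlane

variable {F : Set ℂ} {E : Type} [TopologicalSpace E] {p : E → ↥(Fᶜ)}

/-- **Every finite connected cover of `ℂ ∖ F` (`F` finite, `2 ≤ |F|`) has slim `π̂₁`**: `π₁(ℂ ∖ F)`
is free of rank `|F| ≥ 2` (the tree's `nonempty_mulEquiv_freeGroup_compl_finite`).
[cite: MochizukiAbsAnab2004, Lemma 1.3.1 p.15] -/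
theorem isSlimGroup_profiniteCompletion_fundamentalGroup_of_isCoveringMap_compl_finite
    [PathConnectedSpace E] (hp : IsCoveringMap p) (hF : F.Finite) (h2 : 2 ≤ F.ncard) {x : ↥(Fᶜ)}
    (e : p ⁻¹' {x}) [Finite (p ⁻¹' {x})] :
    IsSlimGroup (profiniteCompletion (FundamentalGroup E (e : E))) := by
  obtain ⟨φ⟩ := nonempty_mulEquiv_freeGroup_compl_finite hF x
  exact isSlimGroup_profiniteCompletion_fundamentalGroup_of_isCoveringMap_fin hp φ h2 e

/-- The categories of finite covers of every finite connected, strongly locally contractible cover of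
`ℂ ∖ F` (`2 ≤ |F| < ∞`) are id-rigid. [cite: MochizukiAbsTopIII2015, Proposition 4.2 (i) p.106] -/
theorem CovFin.isIdRigid_of_isCoveringMap_compl_finite [PathConnectedSpace E]
    [StronglyLocallyContractibleSpace E] (hp : IsCoveringMap p) (hF : F.Finite) (h2 : 2 ≤ F.ncard)
    {x : ↥(Fᶜ)} (e : p ⁻¹' {x}) [Finite (p ⁻¹' {x})] : IsIdRigid (CovFin E) := by
  obtain ⟨φ⟩ := nonempty_mulEquiv_freeGroup_compl_finite hF x
  exact CovFin.isIdRigid_of_isCoveringMap_freeGroup hp φ h2 e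

/-- **The category of CONNECTED finite covers of every finite connected, strongly locally contractible
cover of `ℂ ∖ F` (`2 ≤ |F| < ∞`) is id-rigid** — [AbsTopIII] Prop. 4.2 (i)'s per-object input at every
object of the geometric `EA` over the punctured plane. [cite: MochizukiAbsTopIII2015, Proposition 4.2 (i) p.106] -/
theorem CovFin.isIdRigid_connected_of_isCoveringMap_compl_finite [PathConnectedSpace E]
    [StronglyLocallyContractibleSpace E] (hp : IsCoveringMap p) (hF : F.Finite) (h2 : 2 ≤ F.ncard)
    {x : ↥(Fᶜ)} (e : p ⁻¹' {x}) [Finite (p ⁻¹' {x})] :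
    IsIdRigid (CategoryTheory.ObjectProperty.FullSubcategory
      fun G : CovFin E => ConnectedSpace G.obj.left) := by
  obtain ⟨φ⟩ := nonempty_mulEquiv_freeGroup_compl_finite hF x
  exact CovFin.isIdRigid_connected_of_isCoveringMap_freeGroup hp φ h2 e

end PuncturedPlane

end Literature.Topology.CoveringSpaces
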